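import Literature.MathematicalPhysics.QuantumLattice.HubbardFreeCovariance
import HarnessLib

/-!
# The Wilsonian effective action of the 2D Hubbard torus with a `d`-wave pair seed

Topic `MathematicalPhysics/QuantumLattice`; the definition request `defn-hubbardEffectiveAction`
(route HubbardSuperconductivity/AposterioriCapRg, cruxes CapRgScaleData = stmt-1375 and
AposterioriOrderCriterion = stmt-1381).  With the fields, the seeded free covariance `C` and the
scale decomposition `C = C_{>Λ} + C_{≤Λ}` of `HubbardFreeCovariance.lean`, and the generic
Wilsonian effective action `effAction` of `GrassmannEffectiveAction.lean` (Salmhofer 1999,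
Def. 2.19 (2.102), (4.72), (4.85), Prop. 4.3 (4.88): `μ_C ⋆ = e^{Δ_C}`), this file defines

  `hubbardEffectiveAction L M β U μ h Λ = effAction ℂ C_{>Λ} V`
  `  = -log ( Z_Λ⁻¹ ∫ dμ_{C_{>Λ}}(φ) e^{-V(ψ + φ)} )`  (normalised to zero constant part),

the **effective action at infrared scale `Λ`** of the grand-canonical Hubbard torus
`dWaveSourceTorus L U μ h` at inverse temperature `β` with `2M` Matsubara frequencies, where
`V = U ∫dx ψ⁺_{x↑}ψ⁻_{x↑}ψ⁺_{x↓}ψ⁻_{x↓}` (BGM 2006, (2.6a)) is written in momentum space,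
`V = U (βL²)⁻³ Σ_{k₁+k₃=k₂+k₄} ψ̂⁺_{k₁↑}ψ̂⁻_{k₂↑}ψ̂⁺_{k₃↓}ψ̂⁻_{k₄↓}` (`ψ^±_x = (βL²)⁻¹Σ_k e^{±ikx}ψ̂^±_k`,
(2.5)), together with the constant `Z_Λ = ∫ dμ_{C_{>Λ}} e^{-V}` (`hubbardEffPartitionFn`).
Salmhofer's kernel norms (Salmhofer 1998, §4.1) apply to `𝒢_Λ` through the generic
`actionNorm w ε 𝒢_Λ` of `GrassmannKernels.lean` with the momentum-space integration weight
`ε = (βL²)⁻¹` (`∫ dk = β⁻¹ Σ_ω L⁻² Σ_{k⃗}`, Salmhofer 1998, §2.2).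

## Main statements (all proved)

* `constPart_hubbardInteraction`, `isNilpotent_hubbardInteraction`;
* `hubbardEffectiveAction_semigroup` — **the semigroup property in the scale**:
  `𝒢_Λ = effAction (C_{(Λ,Λ']}) 𝒢_{Λ'}` whenever `Z_{Λ'} ≠ 0` (Salmhofer 1999, (2.106));
  `hubbardEffBoltzmann_semigroup` (Boltzmann factors, unconditionally, (2.105));
* `hubbardEffectiveAction_eq_interaction` (no field above scale ⇒ `𝒢_Λ = V`, the initial
  condition (4.85) at `t = 0`), `hubbardEffectiveAction_eq_of_le` (`0 < Λ ≤ π/β`: everything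
  integrated), `constPart_hubbardEffectiveAction`.

## Sources

G. Benfatto, A. Giuliani, V. Mastropietro, Ann. Henri Poincaré 7 (2006) 809, §2.1–2.2,
(2.5)–(2.13) (arXiv pp. 5–6 of the held copy); bib key `BenfattoGiulianiMastropietro2006`.
M. Salmhofer, *Renormalization* (1999), Def. 2.19, §2.5.1 (2.105)–(2.106), §4.2.5 (4.72), §4.3
Prop. 4.3; bib key `Salmhofer1999`.  M. Salmhofer, Commun. Math. Phys. 194 (1998) 249, §2–4;
bib key `Salmhofer1998`.  W. Pedra, M. Salmhofer, Commun. Math. Phys. 282 (2008) 797 (the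
`M → ∞` problem and determinant constants; context only); bib key `PedraSalmhofer2008`.

## Design choices and what is NOT claimed

* Finite `(β, L, M)`; `𝒢_Λ` is an element of the finite Grassmann algebra `HubbardGrassmann L M`,
  defined for every value of the parameters (no convergence question arises).  Nothing is claimed
  about `M → ∞`, `L → ∞`, or about bounds on the kernels.
* `effAction` is normalised (zero constant part, BGM (2.13)); Salmhofer's `𝒢(t,ψ)` of (4.72) is
  `log Z_Λ - 𝒢_Λ` (sign convention `𝒢(0) = -V`).  The semigroup statement needs `Z_{Λ'} ≠ 0`
  (`Z⁻¹` is `Ring.inverse`); at `U = 0`, `Z_Λ = 1` and `𝒢_Λ = 0` for all `Λ`.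
-/

noncomputable section

namespace Literature.MathematicalPhysics.QuantumLattice

open Literature.Probability.LatticeModels GrassmannAlgebra Finset

/-! ### The interaction and the effective action at scale `Λ` -/

section EffectiveAction

variable (L M : ℕ) [NeZero L]

/-- **The Hubbard interaction in the Grassmann representation**,
`V = U ∫dx ψ⁺_{x↑}ψ⁻_{x↑}ψ⁺_{x↓}ψ⁻_{x↓}` (BGM 2006, (2.6a), `∫dx = ∫₀^β dx₀ Σ_{x⃗}`), in momentum
space: `V = U (βL²)⁻³ Σ_{k₁+k₃=k₂+k₄} ψ̂⁺_{k₁↑} ψ̂⁻_{k₂↑} ψ̂⁺_{k₃↓} ψ̂⁻_{k₄↓}` (four factors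
`(βL²)⁻¹` from (2.5) and `∫dx e^{i(k₁-k₂+k₃-k₄)x} = βL² δ`; conservation of the integer
frequency labels and of `k⃗ ∈ (ℤ/Lℤ)²`; terms whose fourth frequency falls outside the `2M` kept
ones are absent). [cite: BenfattoGiulianiMastropietro2006, §2.1 (2.6a)] -/
def hubbardInteraction (β U : ℝ) : HubbardGrassmann L M :=
  ((U / (β * (L : ℝ) ^ 2) ^ 3 : ℝ) : ℂ) •
    ∑ k₁ : FreqMomentum L M, ∑ k₂ : FreqMomentum L M, ∑ k₃ : FreqMomentum L M, ∑ k₄ : FreqMomentum L M,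
      if matsubaraInt M k₁.1 + matsubaraInt M k₃.1 = matsubaraInt M k₂.1 + matsubaraInt M k₄.1 ∧
          k₁.2 + k₃.2 = k₂.2 + k₄.2 then
        psiPlus k₁ 0 * psiMinus k₂ 0 * psiPlus k₃ 1 * psiMinus k₄ 1
      else 0

/-- The interaction has no constant part. [folklore] -/
theorem constPart_hubbardInteraction (β U : ℝ) : constPart ℂ (hubbardInteraction L M β U) = 0 := by
  simp only [hubbardInteraction, map_smul, map_sum, smul_eq_mul]
  refine mul_eq_zero_of_right _ (Finset.sum_eq_zero fun k₁ _ => Finset.sum_eq_zero fun k₂ _ =>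
    Finset.sum_eq_zero fun k₃ _ => Finset.sum_eq_zero fun k₄ _ => ?_)
  split_ifs
  · simp [psiPlus, psiMinus]
  · exact map_zero _

/-- The interaction is nilpotent. [folklore] -/
theorem isNilpotent_hubbardInteraction (β U : ℝ) : IsNilpotent (hubbardInteraction L M β U) :=
  isNilpotent_of_constPart_eq_zero ℂ (constPart_hubbardInteraction L M β U)

/-- **The Wilsonian effective action of the seeded Hubbard torus at infrared scale `Λ`**:
`𝒢_Λ = -log ( Z_Λ⁻¹ ∫ dμ_{C_{>Λ}}(φ) e^{-V(ψ + φ)} )`, the fields with `|iω - ξ| ≳ Λ` integrated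
out with the free covariance of `dWaveSourceTorus L U μ h` (`hubbardCovAbove`), normalised to zero
constant part — an element of the finite Grassmann algebra on the `ψ̂^±_{kσ}`, `2M` Matsubara
frequencies (Salmhofer 1999, (4.72) `𝒢(t,ψ) = log ∫ dμ_{C_t}(χ) e^{𝒢(0,χ+ψ)}` with
`𝒢(0) = -V`, Prop. 4.3 (4.88); BGM 2006, (2.12)–(2.13)).  Parameters: torus side `L`, Matsubara
cutoff `M`, inverse temperature `β`, interaction `U`, chemical potential `μ`, seed `h`, scale `Λ`.
[cite: Salmhofer1999, §4.2.5 (4.72)] -/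
def hubbardEffectiveAction (β U μ h Λ : ℝ) : HubbardGrassmann L M :=
  effAction ℂ (hubbardCovAbove L M β μ h Λ) (hubbardInteraction L M β U)

/-- The **normalised partition function at scale `Λ`**, `Z_Λ = ∫ dμ_{C_{>Λ}} e^{-V}` (the constant
split off from the effective action; BGM 2006, (2.13) `e^{-L²βF₀}`). [folklore] -/
def hubbardEffPartitionFn (β U μ h Λ : ℝ) : ℂ :=
  effPartitionFn ℂ (hubbardCovAbove L M β μ h Λ) (hubbardInteraction L M β U)

variable (β U μ h : ℝ)

/-- Unfolding `hubbardEffectiveAction`. [folklore] -/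
theorem hubbardEffectiveAction_def (Λ : ℝ) : hubbardEffectiveAction L M β U μ h Λ =
    effAction ℂ (hubbardCovAbove L M β μ h Λ) (hubbardInteraction L M β U) := rfl

/-- The effective action has no constant part (when `Z_Λ ≠ 0`). [folklore] -/
theorem constPart_hubbardEffectiveAction {Λ : ℝ} (hZ : hubbardEffPartitionFn L M β U μ h Λ ≠ 0) :
    constPart ℂ (hubbardEffectiveAction L M β U μ h Λ) = 0 :=
  constPart_effAction ℂ _ _ (isUnit_iff_ne_zero.2 hZ)

/-- **The semigroup property in the scale** (Salmhofer 1999, (2.106); Prop. 4.3): the effective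
action at scale `Λ` is obtained from the one at scale `Λ'` by integrating out the slice
`C_{(Λ,Λ']} = C_{>Λ} - C_{>Λ'}`, provided `Z_{Λ'} ≠ 0`. [cite: Salmhofer1999, §2.5.1 (2.106)] -/
theorem hubbardEffectiveAction_semigroup {Λ' : ℝ} (Λ : ℝ) (hZ : hubbardEffPartitionFn L M β U μ h Λ' ≠ 0) :
    hubbardEffectiveAction L M β U μ h Λ =
      effAction ℂ (hubbardCovSlice L M β μ h Λ Λ') (hubbardEffectiveAction L M β U μ h Λ') := by
  rw [hubbardEffectiveAction, hubbardCovAbove_eq_slice_add L M β μ h Λ Λ', hubbardEffectiveAction]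
  exact effAction_add ℂ _ _ _ (isUnit_iff_ne_zero.2 hZ)

/-- … and at the level of Boltzmann factors, unconditionally:
`μ_{C_{>Λ}} ⋆ e^{-V} = μ_{C_{(Λ,Λ']}} ⋆ (μ_{C_{>Λ'}} ⋆ e^{-V})` (Salmhofer 1999, (2.105)).
[cite: Salmhofer1999, §2.5.1 (2.105)] -/
theorem hubbardEffBoltzmann_semigroup (Λ Λ' : ℝ) :
    effBoltzmann ℂ (hubbardCovAbove L M β μ h Λ) (hubbardInteraction L M β U) =
      gaussConv ℂ (hubbardCovSlice L M β μ h Λ Λ')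
        (effBoltzmann ℂ (hubbardCovAbove L M β μ h Λ') (hubbardInteraction L M β U)) := by
  rw [hubbardCovAbove_eq_slice_add L M β μ h Λ Λ', effBoltzmann_add]

/-- **Initial condition**: if no field is above scale `Λ` then `𝒢_Λ = V` (Salmhofer 1999,
(4.85) at `t = 0`). [folklore] -/
theorem hubbardEffectiveAction_eq_interaction {Λ : ℝ} (hw : ∀ k, hubbardCutoffWeight L M β μ Λ k = 0) :
    hubbardEffectiveAction L M β U μ h Λ = hubbardInteraction L M β U := by
  rw [hubbardEffectiveAction, hubbardCovAbove_eq_zero_of_weight L M hw,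
    effAction_zero_cov ℂ _ (constPart_hubbardInteraction L M β U)]

/-- For `0 < Λ ≤ π/β` everything is integrated: `𝒢_Λ` is the effective action of the full free
covariance (the logarithm of the normalised, amputated generating functional). [folklore] -/
theorem hubbardEffectiveAction_eq_of_le {Λ : ℝ} (hβ : 0 < β) (hΛ : 0 < Λ) (hle : Λ ≤ Real.pi / β) :
    hubbardEffectiveAction L M β U μ h Λ =
      effAction ℂ (hubbardCovariance L M β μ h) (hubbardInteraction L M β U) := by
  rw [hubbardEffectiveAction, hubbardCovAbove_eq_of_le L M hβ hΛ hle]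

end EffectiveAction

end Literature.MathematicalPhysics.QuantumLattice
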